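import Literature.Analysis.Convexity.DoeblinRatioStep
import HarnessLib

/-!
# Hopf's contraction for positive kernels with bounded cross-ratios, via Doeblin (proved)

Topic `Literature/Analysis/Convexity`. A positive kernel `M(i, j) > 0` whose cross-ratios are
bounded, `M(i,j) M(i',j') ≤ K · M(i,j') M(i',j)`, contracts the projective oscillation of positive
row vectors: writing `(uM)(j) = ∑ᵢ u(i) M(i,j)` and `osc(v, v') = max_{j,j'} v(j) v'(j') / (v(j') v'(j))`,

  `osc(uM, u'M) - 1 ≤ (1 - 1/K) · (osc(u, u') - 1)`

(`sum_mul_div_div_le_of_crossRatio`, stated for two fixed columns `j, j'` and a bound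
`A ≤ u(i)/u'(i) ≤ B`: the double ratio is at most `1/K + (1 - 1/K) · B/A`). This is a quantitative
form of E. Hopf's theorem (*An inequality for positive linear integral operators*, J. Math. Mech. 12
(1963), Thm. 1; G. Birkhoff 1957) in the form used by H. Kesten, PTRF 73 (1986), eqs. (24)–(25):
iterating, the oscillation of `u M₁ ⋯ Mₛ` against `u' M₁ ⋯ Mₛ` decays geometrically, so ratios of
arm probabilities forget the far data. (Hopf's sharp rate `(√K - 1)/(√K + 1)` in the projective
metric is not needed; the Doeblin rate `1 - 1/K` in `osc - 1` suffices.) Proof: the cross-ratio bound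
says exactly that the normalised columns `i ↦ M(i,j) u'(i)` overlap to the extent `1/K` on the column
`j'`, and `ratio_div_ratio_le_of_overlap` (`DoeblinRatioStep.lean`) applies with no junk.
Everything is proved; no definitions.

## References

* E. Hopf, An inequality for positive linear integral operators, *J. Math. Mech.* 12 (1963) 683–692, Thm. 1.
* H. Kesten, The incipient infinite cluster in two-dimensional percolation, *Probab. Theory Related
  Fields* 73 (1986), eqs. (24)–(25) and Lemma (23).
-/

open Finset

namespace Literature.Analysis.Convexity.Doeblin

variable {ι : Type*}

/-- **Hopf's contraction via Doeblin.** Let `M(i, j), M(i, j') > 0` (`i ∈ s`) be two columns of a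
positive kernel with the cross-ratio bound `M(i,j') M(i',j) ≤ K · M(i,j) M(i',j')` for all `i, i' ∈ s`
(`1 ≤ K`), and let `u, u' > 0` be row vectors with `A ≤ u(i)/u'(i) ≤ B` (`0 < A`). Then
`[(uM)(j)/(u'M)(j)] / [(uM)(j')/(u'M)(j')] ≤ 1/K + (1 - 1/K) · B/A`; with `B/A = osc(u,u')` and the
symmetric instance this is `osc(uM, u'M) - 1 ≤ (1 - 1/K)(osc(u,u') - 1)`.
[cite: Kesten1986, eqs. (24)–(25)] -/
theorem sum_mul_div_div_le_of_crossRatio (s : Finset ι) (Mj Mj' u u' : ι → ℝ) {K A B : ℝ}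
    (hMj : ∀ i ∈ s, 0 < Mj i) (hMj' : ∀ i ∈ s, 0 < Mj' i) (hK : 1 ≤ K)
    (hcross : ∀ i ∈ s, ∀ i' ∈ s, Mj' i * Mj i' ≤ K * (Mj i * Mj' i'))
    (hu : ∀ i ∈ s, 0 < u i) (hu' : ∀ i ∈ s, 0 < u' i) (hA : 0 < A)
    (hr : ∀ i ∈ s, A ≤ u i / u' i ∧ u i / u' i ≤ B) (hs : s.Nonempty) :
    (∑ i ∈ s, Mj i * u i) / (∑ i ∈ s, Mj i * u' i) /
        ((∑ i ∈ s, Mj' i * u i) / (∑ i ∈ s, Mj' i * u' i)) ≤ 1 / K + (1 - 1 / K) * B / A := by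
  have hK0 : 0 < K := one_pos.trans_le hK
  -- the reference probability vector: the normalised column `j'` weighted by `u'`
  set S' := ∑ i ∈ s, Mj' i * u' i with hS'def
  have hS' : 0 < S' := Finset.sum_pos (fun i hi => mul_pos (hMj' i hi) (hu' i hi)) hs
  have hS : 0 < ∑ i ∈ s, Mj i * u' i := Finset.sum_pos (fun i hi => mul_pos (hMj i hi) (hu' i hi)) hs
  set ν : ι → ℝ := fun i => Mj' i * u' i / S' with hνdef
  have hν0 : ∀ i ∈ s, 0 ≤ ν i := fun i hi => by
    simp only [hνdef]; exact div_nonneg (mul_pos (hMj' i hi) (hu' i hi)).le hS'.le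
  have hν1 : ∑ i ∈ s, ν i = 1 := by
    simp only [hνdef]; rw [← Finset.sum_div, div_self hS'.ne']
  -- overlap `1/K` of the column `j` on `ν` (the cross-ratio bound), overlap `1/K ≤ 1` of `j'` on itself
  have hov₁ : ∀ i ∈ s, 1 / K * ν i * (∑ i' ∈ s, Mj i' * u' i') ≤ Mj i * u' i := by
    intro i hi
    have hsum : Mj' i * u' i * ∑ i' ∈ s, Mj i' * u' i' ≤ K * (Mj i * u' i) * S' := by
      rw [hS'def, Finset.mul_sum, Finset.mul_sum]
      refine Finset.sum_le_sum fun i' hi' => ?_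
      have hc := hcross i hi i' hi'
      have hu'i := (hu' i hi).le
      have hu'i' := (hu' i' hi').le
      calc Mj' i * u' i * (Mj i' * u' i') = (Mj' i * Mj i') * (u' i * u' i') := by ring
        _ ≤ (K * (Mj i * Mj' i')) * (u' i * u' i') :=
            mul_le_mul_of_nonneg_right hc (mul_nonneg hu'i hu'i')
        _ = K * (Mj i * u' i) * (Mj' i' * u' i') := by ring
    have heq : 1 / K * ν i * (∑ i' ∈ s, Mj i' * u' i') =
        (Mj' i * u' i * ∑ i' ∈ s, Mj i' * u' i') / (K * S') := by
      simp only [hνdef]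
      field_simp
    rw [heq, div_le_iff₀ (mul_pos hK0 hS')]
    calc Mj' i * u' i * ∑ i' ∈ s, Mj i' * u' i' ≤ K * (Mj i * u' i) * S' := hsum
      _ = Mj i * u' i * (K * S') := by ring
  have hov₂ : ∀ i ∈ s, 1 / K * ν i * (∑ i' ∈ s, Mj' i' * u' i') ≤ Mj' i * u' i := by
    intro i hi
    have h0 : 0 ≤ Mj' i * u' i := (mul_pos (hMj' i hi) (hu' i hi)).le
    have heq : 1 / K * ν i * (∑ i' ∈ s, Mj' i' * u' i') = (Mj' i * u' i) / K := by
      simp only [hνdef]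
      rw [← hS'def]
      field_simp
    rw [heq, div_le_iff₀ hK0]
    nlinarith
  -- the ratio bounds in the form `A ≤ u/u' ≤ B`
  have hβ0 : 0 ≤ 1 / K := (div_pos one_pos hK0).le
  have hβ1 : 1 / K ≤ 1 := by rw [div_le_one hK0]; exact hK
  have key := ratio_div_ratio_le_of_overlap s u u' Mj Mj' ν
    (A := A) (B := B) (β := 1 / K) (ε := 0)
    (N₁ := ∑ i ∈ s, Mj i * u i) (M₁ := ∑ i ∈ s, Mj i * u' i)
    (N₂ := ∑ i ∈ s, Mj' i * u i) (M₂ := ∑ i ∈ s, Mj' i * u' i)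
    (e₁ := 0) (e₁' := 0) (e₂ := 0) (e₂' := 0)
    hu' hA hr (fun i hi => (hMj i hi).le) (fun i hi => (hMj' i hi).le) hS hS' hν0 hν1 hβ0 hβ1
    hov₁ hov₂ one_pos (by simp) (by simp) (by simp) (by simp)
    ⟨le_rfl, by simp⟩ ⟨le_rfl, by simp⟩ ⟨le_rfl, by simp⟩ ⟨le_rfl, by simp⟩
  have hMpos : 0 < (∑ i ∈ s, Mj' i * u i) / (∑ i ∈ s, Mj' i * u' i) :=
    div_pos (Finset.sum_pos (fun i hi => mul_pos (hMj' i hi) (hu i hi)) hs) hS'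
  rw [div_le_iff₀ hMpos]
  calc (∑ i ∈ s, Mj i * u i) / (∑ i ∈ s, Mj i * u' i)
      ≤ (1 / K + (1 - 1 / K) * B / A) / (1 - 0) ^ 2 *
          ((∑ i ∈ s, Mj' i * u i) / (∑ i ∈ s, Mj' i * u' i)) := key
    _ = (1 / K + (1 - 1 / K) * B / A) * ((∑ i ∈ s, Mj' i * u i) / (∑ i ∈ s, Mj' i * u' i)) := by
        norm_num


/-- **One application bounds the oscillation by the cross-ratio constant.** For two positive columns
with `M(i,j) M(i',j') ≤ K · M(i,j') M(i',j)` (`i, i' ∈ s`) and ANY positive row vectors `u, u'`,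
`[(uM)(j)/(u'M)(j)] / [(uM)(j')/(u'M)(j')] ≤ K` (expand both double sums and compare termwise): the
image of the whole positive cone under a kernel with bounded cross-ratios has bounded projective
diameter — the start of the geometric decay. [cite: Kesten1986, eqs. (24)–(25)] -/
theorem sum_mul_div_div_le_crossRatio_const (s : Finset ι) (Mj Mj' u u' : ι → ℝ) {K : ℝ}
    (hMj : ∀ i ∈ s, 0 < Mj i) (hMj' : ∀ i ∈ s, 0 < Mj' i)
    (hcross' : ∀ i ∈ s, ∀ i' ∈ s, Mj i * Mj' i' ≤ K * (Mj' i * Mj i'))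
    (hu : ∀ i ∈ s, 0 < u i) (hu' : ∀ i ∈ s, 0 < u' i) (hs : s.Nonempty) :
    (∑ i ∈ s, Mj i * u i) / (∑ i ∈ s, Mj i * u' i) /
        ((∑ i ∈ s, Mj' i * u i) / (∑ i ∈ s, Mj' i * u' i)) ≤ K := by
  have hA : 0 < ∑ i ∈ s, Mj i * u' i := Finset.sum_pos (fun i hi => mul_pos (hMj i hi) (hu' i hi)) hs
  have hB : 0 < ∑ i ∈ s, Mj' i * u i := Finset.sum_pos (fun i hi => mul_pos (hMj' i hi) (hu i hi)) hs
  have hC : 0 < ∑ i ∈ s, Mj' i * u' i := Finset.sum_pos (fun i hi => mul_pos (hMj' i hi) (hu' i hi)) hs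
  -- cross-multiplied form
  have key : (∑ i ∈ s, Mj i * u i) * (∑ i ∈ s, Mj' i * u' i) ≤
      K * ((∑ i ∈ s, Mj' i * u i) * (∑ i ∈ s, Mj i * u' i)) := by
    rw [Finset.sum_mul_sum, Finset.sum_mul_sum, Finset.mul_sum]
    refine Finset.sum_le_sum fun i hi => ?_
    rw [Finset.mul_sum]
    refine Finset.sum_le_sum fun i' hi' => ?_
    have hc := hcross' i hi i' hi'
    have h0 : 0 ≤ u i * u' i' := (mul_pos (hu i hi) (hu' i' hi')).le
    calc Mj i * u i * (Mj' i' * u' i') = (Mj i * Mj' i') * (u i * u' i') := by ring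
      _ ≤ (K * (Mj' i * Mj i')) * (u i * u' i') := mul_le_mul_of_nonneg_right hc h0
      _ = K * (Mj' i * u i * (Mj i' * u' i')) := by ring
  rw [div_div_eq_mul_div, div_mul_eq_mul_div, div_div, div_le_iff₀ (mul_pos hA hB)]
  calc (∑ i ∈ s, Mj i * u i) * (∑ i ∈ s, Mj' i * u' i)
      ≤ K * ((∑ i ∈ s, Mj' i * u i) * (∑ i ∈ s, Mj i * u' i)) := key
    _ = K * ((∑ i ∈ s, Mj i * u' i) * (∑ i ∈ s, Mj' i * u i)) := by ring


/-- **Geometric decay of the oscillation under iteration** (Kesten 1986, after (25): "by induction on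
`s`"). If `Q₀ ≤ K` and `Q_{n+1} ≤ 1/K + (1 - 1/K) Qₙ` for all `n` (one application of a kernel with
cross-ratios `≤ K`, `sum_mul_div_div_le_crossRatio_const` then `sum_mul_div_div_le_of_crossRatio`),
then `Qₙ - 1 ≤ (1 - 1/K)ⁿ (K - 1)`. [cite: Kesten1986, eqs. (24)–(25)] -/
theorem sub_one_le_pow_mul_of_contraction (Q : ℕ → ℝ) {K : ℝ} (hK : 1 ≤ K) (h0 : Q 0 ≤ K)
    (hstep : ∀ n, Q (n + 1) ≤ 1 / K + (1 - 1 / K) * Q n) :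
    ∀ n, Q n - 1 ≤ (1 - 1 / K) ^ n * (K - 1) := by
  have hK0 : 0 < K := one_pos.trans_le hK
  have hθ : 0 ≤ 1 - 1 / K := by
    rw [sub_nonneg, div_le_one hK0]; exact hK
  intro n
  induction n with
  | zero => simpa using h0
  | succ n ih =>
    have h1 : Q (n + 1) - 1 ≤ (1 - 1 / K) * (Q n - 1) := by
      have := hstep n
      have e : 1 / K + (1 - 1 / K) * Q n - 1 = (1 - 1 / K) * (Q n - 1) := by ring
      linarith
    calc Q (n + 1) - 1 ≤ (1 - 1 / K) * (Q n - 1) := h1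
      _ ≤ (1 - 1 / K) * ((1 - 1 / K) ^ n * (K - 1)) := mul_le_mul_of_nonneg_left ih hθ
      _ = (1 - 1 / K) ^ (n + 1) * (K - 1) := by ring

end Literature.Analysis.Convexity.Doeblin
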